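import Mathlib
import HarnessLib

/-!
# Stub `stub_laplaceHeatVariance` of line `canonical-rigidity`
(crux `CageBudgetFekete.HeatVarianceCalculus`, item stmt-AtomisticToContinuum-15772; `--supports` file, closes nothing;
line lead, 2026-08-17)

WHAT. The registered stub 2 of the crux's skeleton
(`Cruxes/HeatVarianceCalculus/Lines/canonical_rigidity.lean`, shared verbatim with line `birth`): for a continuous
bounded `C : ℝ → ℝ` and `V(τ) = 2∫_{(0,τ]}(τ-s)C(s)ds`, for every `ν > 0` the Laplace integrands `e^{-νt}C(t)` and
`e^{-νt}V(t)` are integrable on `(0,∞)` and `∫₀^∞ e^{-νt}C = (ν²/2)∫₀^∞ e^{-νt}V` — the model-free Laplace calculus of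
the doubly integrated current autocorrelation (Einstein–Helfand heat variance), `V'' = 2C`, `V(0) = V'(0) = 0`.

HOW. Pure real analysis: `V = W := 2(tF − G)` on `[0,∞)` with `F, G` the primitives of `C` and `sC`
(FTC, `Continuous.integral_hasStrictDerivAt`), `W' = 2F`, `F' = C`; polynomial bounds `|F| ≤ Mt`, `|W| ≤ 4Mt²`
give Laplace integrability (`integrable_of_isBigO_exp_neg`) and decay at `+∞`; two integrations by parts on
`(0,∞)` (`integral_Ioi_mul_deriv_eq_deriv_mul`) give `∫e^{-νt}C = ν∫e^{-νt}F` and `2∫e^{-νt}F = ν∫e^{-νt}W`.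
Proof text assembled by the crux strategist (evidence `laplace-proof.lean`, `HeatVarianceCalculus-complete.lean`)
and landed verbatim by the line lead.
-/

noncomputable section

namespace Summit.AtomisticToContinuum.FouriersLaw.Theorems.HeatVarianceCalculus.CanonicalRigidity

open MeasureTheory Filter Set Function Asymptotics intervalIntegral
open scoped Topology BigOperators

/-- `d/dt e^{-νt} = -ν e^{-νt}`. [folklore] -/
theorem hasDerivAt_exp_neg_mul (ν t : ℝ) :
    HasDerivAt (fun x : ℝ => Real.exp (-(ν * x))) (-ν * Real.exp (-(ν * t))) t :=
  (((hasDerivAt_id' t).const_mul ν).fun_neg.exp).congr_deriv (by ring)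

/-- A continuous function with a polynomial bound on `[0, ∞)` is Laplace-integrable on `(0, ∞)`. [folklore] -/
theorem integrableOn_exp_neg_mul_of_abs_le_pow {g : ℝ → ℝ} (hg : Continuous g) {K : ℝ} {n : ℕ}
    (hb : ∀ t : ℝ, 0 ≤ t → |g t| ≤ K * t ^ n) {ν : ℝ} (hν : 0 < ν) :
    IntegrableOn (fun t : ℝ => Real.exp (-(ν * t)) * g t) (Ioi 0) := by
  have hcont : ContinuousOn (fun t : ℝ => Real.exp (-(ν * t)) * g t) (Ici 0) :=
    (Continuous.mul (by fun_prop) hg).continuousOn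
  have h1 : g =O[atTop] fun t : ℝ => t ^ n := by
    refine IsBigO.of_bound K ?_
    filter_upwards [eventually_ge_atTop (0 : ℝ)] with t ht
    rw [Real.norm_eq_abs, Real.norm_eq_abs, abs_of_nonneg (pow_nonneg ht n)]
    exact hb t ht
  have h2 : (fun t : ℝ => t ^ n) =o[atTop] fun t : ℝ => Real.exp (ν / 2 * t) :=
    isLittleO_pow_exp_pos_mul_atTop n (half_pos hν)
  have h3 : g =O[atTop] fun t : ℝ => Real.exp (ν / 2 * t) := h1.trans h2.isBigO
  have h4 : (fun t : ℝ => Real.exp (-(ν * t))) =O[atTop] fun t : ℝ => Real.exp (-(ν * t)) :=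
    isBigO_refl _ _
  have h5 := h4.mul h3
  have ho : (fun t : ℝ => Real.exp (-(ν * t)) * g t) =O[atTop] fun t : ℝ => Real.exp (-(ν / 2) * t) :=
    h5.congr_right fun t => by
      rw [← Real.exp_add]
      congr 1
      ring
  exact integrable_of_isBigO_exp_neg (half_pos hν) hcont ho

/-- `e^{-νt} g(t) → 0` at `+∞` under a polynomial bound. [folklore] -/
theorem tendsto_exp_neg_mul_mul_atTop {g : ℝ → ℝ} {K : ℝ} {n : ℕ}
    (hb : ∀ t : ℝ, 0 ≤ t → |g t| ≤ K * t ^ n) {ν : ℝ} (hν : 0 < ν) :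
    Tendsto (fun t : ℝ => Real.exp (-(ν * t)) * g t) atTop (𝓝 0) := by
  have h0 : Tendsto (fun t : ℝ => t ^ (n : ℝ) * Real.exp (-ν * t)) atTop (𝓝 0) :=
    tendsto_rpow_mul_exp_neg_mul_atTop_nhds_zero (n : ℝ) ν hν
  have h1 : Tendsto (fun t : ℝ => K * (t ^ n * Real.exp (-(ν * t)))) atTop (𝓝 0) := by
    have h := h0.const_mul K
    rw [mul_zero] at h
    refine h.congr' ?_
    filter_upwards [eventually_ge_atTop (0 : ℝ)] with t ht
    rw [Real.rpow_natCast, neg_mul]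
  refine squeeze_zero_norm' ?_ h1
  filter_upwards [eventually_ge_atTop (0 : ℝ)] with t ht
  rw [norm_mul, Real.norm_eq_abs, Real.norm_eq_abs, abs_of_pos (Real.exp_pos _)]
  calc Real.exp (-(ν * t)) * |g t| ≤ Real.exp (-(ν * t)) * (K * t ^ n) :=
        mul_le_mul_of_nonneg_left (hb t ht) (Real.exp_pos _).le
    _ = K * (t ^ n * Real.exp (-(ν * t))) := by ring

/-- **Stub `stub_laplaceHeatVariance` (registered signature, verbatim): Laplace calculus of the doubly
integrated correlation.** For continuous bounded `C` and `V(τ) = 2∫_{(0,τ]}(τ-s)C(s)ds`, for every `ν > 0`: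
`e^{-νt}C, e^{-νt}V ∈ L¹(0,∞)` and `∫₀^∞e^{-νt}C = (ν²/2)∫₀^∞e^{-νt}V` (`V'' = 2C`, `V(0) = V'(0) = 0`; two
integrations by parts). [folklore] -/
theorem stub_laplaceHeatVariance :
    ∀ C : ℝ → ℝ, Continuous C → (∃ M : ℝ, ∀ t : ℝ, |C t| ≤ M) → ∀ V : ℝ → ℝ,
    V = (fun τ : ℝ => 2 * ∫ s in Set.Ioc (0:ℝ) τ, (τ - s) * C s) → ∀ ν : ℝ, 0 < ν →
    MeasureTheory.IntegrableOn (fun t : ℝ => Real.exp (-(ν * t)) * C t) (Set.Ioi 0) ∧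
    MeasureTheory.IntegrableOn (fun t : ℝ => Real.exp (-(ν * t)) * V t) (Set.Ioi 0) ∧
    ∫ t in Set.Ioi (0:ℝ), Real.exp (-(ν * t)) * C t =
      ν ^ 2 / 2 * ∫ t in Set.Ioi (0:ℝ), Real.exp (-(ν * t)) * V t := by
  intro C hC hM V hV ν hν
  obtain ⟨M, hM⟩ := hM
  have hM0 : 0 ≤ M := (abs_nonneg _).trans (hM 0)
  -- the primitives
  set F : ℝ → ℝ := fun t => ∫ s in (0:ℝ)..t, C s with hF
  set G : ℝ → ℝ := fun t => ∫ s in (0:ℝ)..t, s * C s with hG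
  set W : ℝ → ℝ := fun t => 2 * (t * F t - G t) with hW
  have hsC : Continuous fun s : ℝ => s * C s := continuous_id.mul hC
  have hFd : ∀ t, HasDerivAt F (C t) t := fun t => (hC.integral_hasStrictDerivAt 0 t).hasDerivAt
  have hGd : ∀ t, HasDerivAt G (t * C t) t := fun t => (hsC.integral_hasStrictDerivAt 0 t).hasDerivAt
  have hWd : ∀ t, HasDerivAt W (2 * F t) t := fun t =>
    ((((hasDerivAt_id' t).mul (hFd t)).sub (hGd t)).const_mul (2:ℝ)).congr_deriv (by ring)
  have hFc : Continuous F := continuous_iff_continuousAt.2 fun t => (hFd t).continuousAt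
  have hWc : Continuous W := continuous_iff_continuousAt.2 fun t => (hWd t).continuousAt
  have hF0 : F 0 = 0 := by simp [hF]
  have hW0 : W 0 = 0 := by simp [hW, hG]
  -- bounds
  have hFb : ∀ t : ℝ, 0 ≤ t → |F t| ≤ M * t ^ 1 := fun t ht => by
    have h := norm_integral_le_of_norm_le_const (a := (0:ℝ)) (b := t) (C := M) (f := C)
      fun x _ => by rw [Real.norm_eq_abs]; exact hM x
    rw [Real.norm_eq_abs, sub_zero, abs_of_nonneg ht] at h
    simpa [pow_one] using h
  have hGb : ∀ t : ℝ, 0 ≤ t → |G t| ≤ M * t ^ 2 := fun t ht => by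
    have h := norm_integral_le_of_norm_le_const (a := (0:ℝ)) (b := t) (C := t * M) (f := fun s => s * C s)
      fun x hx => by
        rw [uIoc_of_le ht] at hx
        rw [Real.norm_eq_abs, abs_mul, abs_of_nonneg hx.1.le]
        exact mul_le_mul hx.2 (hM x) (abs_nonneg _) ht
    rw [Real.norm_eq_abs, sub_zero, abs_of_nonneg ht] at h
    calc |G t| ≤ t * M * t := h
      _ = M * t ^ 2 := by ring
  have hWb : ∀ t : ℝ, 0 ≤ t → |W t| ≤ 4 * M * t ^ 2 := fun t ht => by
    have h1 := hFb t ht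
    have h2 := hGb t ht
    rw [pow_one] at h1
    have h3 : |t * F t - G t| ≤ t * (M * t) + M * t ^ 2 := by
      refine (abs_sub _ _).trans (add_le_add ?_ h2)
      rw [abs_mul, abs_of_nonneg ht]
      exact mul_le_mul_of_nonneg_left h1 ht
    show |2 * (t * F t - G t)| ≤ 4 * M * t ^ 2
    rw [abs_mul, abs_of_pos (by norm_num : (0:ℝ) < 2)]
    nlinarith
  have hCb : ∀ t : ℝ, 0 ≤ t → |C t| ≤ M * t ^ 0 := fun t _ => by simpa using hM t
  have h2Fb : ∀ t : ℝ, 0 ≤ t → |2 * F t| ≤ 2 * M * t ^ 1 := fun t ht => by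
    rw [abs_mul, abs_of_pos (by norm_num : (0:ℝ) < 2)]
    have := hFb t ht
    nlinarith
  -- `V = W` on `(0, ∞)`
  have hVW : ∀ t : ℝ, 0 ≤ t → V t = W t := fun t ht => by
    subst hV
    show 2 * ∫ s in Set.Ioc (0:ℝ) t, (t - s) * C s = 2 * (t * F t - G t)
    congr 1
    rw [← integral_of_le ht]
    have e : (fun s : ℝ => (t - s) * C s) = fun s => t * C s - s * C s := funext fun s => by ring
    rw [e, integral_sub ((hC.const_mul t).intervalIntegrable _ _) (hsC.intervalIntegrable _ _),
      intervalIntegral.integral_const_mul]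
  have hVWon : EqOn (fun t : ℝ => Real.exp (-(ν * t)) * V t) (fun t : ℝ => Real.exp (-(ν * t)) * W t) (Ioi 0) :=
    fun t ht => by simp only [hVW t (le_of_lt ht)]
  -- integrability of all the Laplace integrands
  have hiC : IntegrableOn (fun t : ℝ => Real.exp (-(ν * t)) * C t) (Ioi 0) :=
    integrableOn_exp_neg_mul_of_abs_le_pow hC hCb hν
  have hiF : IntegrableOn (fun t : ℝ => Real.exp (-(ν * t)) * F t) (Ioi 0) :=
    integrableOn_exp_neg_mul_of_abs_le_pow hFc hFb hν
  have hi2F : IntegrableOn (fun t : ℝ => Real.exp (-(ν * t)) * (2 * F t)) (Ioi 0) :=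
    integrableOn_exp_neg_mul_of_abs_le_pow (continuous_const.mul hFc) h2Fb hν
  have hiW : IntegrableOn (fun t : ℝ => Real.exp (-(ν * t)) * W t) (Ioi 0) :=
    integrableOn_exp_neg_mul_of_abs_le_pow hWc hWb hν
  have hiV : IntegrableOn (fun t : ℝ => Real.exp (-(ν * t)) * V t) (Ioi 0) :=
    hiW.congr_fun hVWon.symm measurableSet_Ioi
  -- first integration by parts: `∫ e^{-νt} C = ν ∫ e^{-νt} F`
  have ibp1 : ∫ t in Ioi (0:ℝ), Real.exp (-(ν * t)) * C t =
      0 - 0 - ∫ t in Ioi (0:ℝ), (-ν * Real.exp (-(ν * t))) * F t := by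
    refine integral_Ioi_mul_deriv_eq_deriv_mul (u := fun t => Real.exp (-(ν * t)))
      (u' := fun t => -ν * Real.exp (-(ν * t))) (v := F) (v' := C)
      (fun t _ => hasDerivAt_exp_neg_mul ν t) (fun t _ => hFd t) hiC ?_ ?_ ?_
    · have e : (fun t => -ν * Real.exp (-(ν * t))) * F = fun t => -ν * (Real.exp (-(ν * t)) * F t) :=
        funext fun t => by simp only [Pi.mul_apply]; ring
      rw [e]
      exact hiF.const_mul _
    · have h : Tendsto (fun t : ℝ => Real.exp (-(ν * t)) * F t) (𝓝[>] 0) (𝓝 (Real.exp (-(ν * 0)) * F 0)) :=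
        ((Continuous.mul (by fun_prop) hFc : Continuous fun t : ℝ => Real.exp (-(ν * t)) * F t).tendsto 0).mono_left
          nhdsWithin_le_nhds
      simpa [hF0, Pi.mul_def] using h
    · exact tendsto_exp_neg_mul_mul_atTop hFb hν
  -- second integration by parts: `∫ e^{-νt} (2F) = ν ∫ e^{-νt} W`
  have ibp2 : ∫ t in Ioi (0:ℝ), Real.exp (-(ν * t)) * (2 * F t) =
      0 - 0 - ∫ t in Ioi (0:ℝ), (-ν * Real.exp (-(ν * t))) * W t := by
    refine integral_Ioi_mul_deriv_eq_deriv_mul (u := fun t => Real.exp (-(ν * t)))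
      (u' := fun t => -ν * Real.exp (-(ν * t))) (v := W) (v' := fun t => 2 * F t)
      (fun t _ => hasDerivAt_exp_neg_mul ν t) (fun t _ => hWd t) hi2F ?_ ?_ ?_
    · have e : (fun t => -ν * Real.exp (-(ν * t))) * W = fun t => -ν * (Real.exp (-(ν * t)) * W t) :=
        funext fun t => by simp only [Pi.mul_apply]; ring
      rw [e]
      exact hiW.const_mul _
    · have h : Tendsto (fun t : ℝ => Real.exp (-(ν * t)) * W t) (𝓝[>] 0) (𝓝 (Real.exp (-(ν * 0)) * W 0)) :=
        ((Continuous.mul (by fun_prop) hWc : Continuous fun t : ℝ => Real.exp (-(ν * t)) * W t).tendsto 0).mono_left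
          nhdsWithin_le_nhds
      simpa [hW0, Pi.mul_def] using h
    · exact tendsto_exp_neg_mul_mul_atTop hWb hν
  -- linear algebra of the two identities
  have e1 : ∫ t in Ioi (0:ℝ), (-ν * Real.exp (-(ν * t))) * F t =
      -ν * ∫ t in Ioi (0:ℝ), Real.exp (-(ν * t)) * F t := by
    rw [← MeasureTheory.integral_const_mul]
    refine integral_congr_ae (Eventually.of_forall fun t => ?_)
    ring
  have e2 : ∫ t in Ioi (0:ℝ), (-ν * Real.exp (-(ν * t))) * W t =
      -ν * ∫ t in Ioi (0:ℝ), Real.exp (-(ν * t)) * W t := by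
    rw [← MeasureTheory.integral_const_mul]
    refine integral_congr_ae (Eventually.of_forall fun t => ?_)
    ring
  have e3 : ∫ t in Ioi (0:ℝ), Real.exp (-(ν * t)) * (2 * F t) =
      2 * ∫ t in Ioi (0:ℝ), Real.exp (-(ν * t)) * F t := by
    rw [← MeasureTheory.integral_const_mul]
    refine integral_congr_ae (Eventually.of_forall fun t => ?_)
    ring
  have e4 : ∫ t in Ioi (0:ℝ), Real.exp (-(ν * t)) * V t = ∫ t in Ioi (0:ℝ), Real.exp (-(ν * t)) * W t :=
    setIntegral_congr_fun measurableSet_Ioi hVWon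
  refine ⟨hiC, hiV, ?_⟩
  rw [e1] at ibp1
  rw [e2, e3] at ibp2
  rw [e4]
  -- ibp1: ∫C = ν ∫F ; ibp2: 2∫F = ν ∫W
  have h1 : ∫ t in Ioi (0:ℝ), Real.exp (-(ν * t)) * C t = ν * ∫ t in Ioi (0:ℝ), Real.exp (-(ν * t)) * F t := by
    rw [ibp1]; ring
  have h2 : 2 * ∫ t in Ioi (0:ℝ), Real.exp (-(ν * t)) * F t = ν * ∫ t in Ioi (0:ℝ), Real.exp (-(ν * t)) * W t := by
    rw [ibp2]; ring
  calc ∫ t in Ioi (0:ℝ), Real.exp (-(ν * t)) * C t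
      = ν / 2 * (2 * ∫ t in Ioi (0:ℝ), Real.exp (-(ν * t)) * F t) := by rw [h1]; ring
    _ = ν / 2 * (ν * ∫ t in Ioi (0:ℝ), Real.exp (-(ν * t)) * W t) := by rw [h2]
    _ = ν ^ 2 / 2 * ∫ t in Ioi (0:ℝ), Real.exp (-(ν * t)) * W t := by ring

end Summit.AtomisticToContinuum.FouriersLaw.Theorems.HeatVarianceCalculus.CanonicalRigidity

end
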